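import Summits.Ventures.PackingBounds.ThreePointCert.C9ECertC

/-!
# A(9, arccos 1/3) ≤ 98: kernel instance of the exact value-99 three-point certificate — kernel validation of the three-point part and of the positivity certificate of h

Framing: lottery ticket; floor = certified bounds/negative ranges. Venture `PackingBounds` (cell
`pub-packcert`), three-point SDP family. Integer data of the EXACT (slack-free) Bachoc–Vallentin
certificate of value exactly `99` for `A(9, arccos 1/3)` (n = 9, s = 1/3, degree 10, symmetric sums of
squares, `B = 0`; every block on its optimal face), produced by `pub-packcert-lp` gen 4 (`code/k99/job4.py`,
strategy S4_a_R0rest_F) from the cell's exact certificate `sdp-n9-d10-s1-3-sym-exact99-r2.json` (pub-packcert-sdp gen 4;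
two independent exact verifiers + referee), in the units of the kernel checker `ThreePointCert.CheckExact`
(soundness `ThreePointCert.SoundExact`, `SoundExact2`). Generated file: plain lists of integers / monomials.
-/

namespace Summit.Ventures.PackingBounds.ThreePointCert.C9E

open Literature.Geometry.DiscreteGeometry Literature.Geometry.DiscreteGeometry.PolyCert PolyCert.SPoly

set_option maxHeartbeats 0 in
/-- Three-point expansion, blocks [0, 1] (kernel). -/
theorem okF_1 : FchunkOKX 9 10 [fb0, fb1] ([] : SPoly) dF_1 = true := by
  decide +kernel

set_option maxHeartbeats 0 in
/-- Three-point expansion, blocks [2, 3] (kernel). -/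
theorem okF_2 : FchunkOKX 9 10 [fb2, fb3] dF_1 dF_2 = true := by
  decide +kernel

set_option maxHeartbeats 0 in
/-- Three-point expansion, blocks [4] (kernel). -/
theorem okF_3 : FchunkOKX 9 10 [fb4] dF_2 dF_3 = true := by
  decide +kernel

set_option maxHeartbeats 0 in
/-- Three-point expansion, blocks [5] (kernel). -/
theorem okF_4 : FchunkOKX 9 10 [fb5] dF_3 dF_4 = true := by
  decide +kernel

set_option maxHeartbeats 0 in
/-- Three-point expansion, blocks [6, 7] (kernel). -/
theorem okF_5 : FchunkOKX 9 10 [fb6, fb7] dF_4 dF_5 = true := by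
  decide +kernel

set_option maxHeartbeats 0 in
/-- Three-point expansion, blocks [8, 9] (kernel). -/
theorem okF_6 : FchunkOKX 9 10 [fb8, fb9] dF_5 eFP = true := by
  decide +kernel

set_option maxHeartbeats 0 in
/-- Gram expansion of the positivity certificate of `h`, multiplier 1 (kernel). -/
theorem okH0 : chunkOK gh0 0 8 [] eEH0 = true := by
  decide +kernel

set_option maxHeartbeats 0 in
/-- Gram expansion of the positivity certificate of `h`, multiplier `g_q` (kernel). -/
theorem okH1 : chunkOK gh1 0 7 [] eEH1 = true := by
  decide +kernel

end Summit.Ventures.PackingBounds.ThreePointCert.C9E
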